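import Summits.FinalStateConjecture.FinalStateConjecture.Theorems.PhotonSphereChannelsWindowedShellChannelsOfZonePoly

/-!
# Crux `WindowedShellChannels` (stmt-FinalStateConjecture-14085) — the PARITY SPLIT of the landed kernel

The crux is reduced to its kernel (`windowedShellChannels_of_zonePoly`, p135139: W ⇐ the polynomial-zone kernel for every real
time parity `σ`).  Only `σ = ±1` carry content: a function of time parity `σ` with `σ² ≠ 1` vanishes identically
(`ParitySplit.eq_zero_of_parity_ne`).  This file lands the glue of the strategist's split (crux evidence
`PhotonSphereChannelsWindowedShellChannelsSplit.lean`, line `parity-kernels`, 2026-08-17): the EVEN kernel (time-even solutions,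
data `(ψ₀, 0)`) and the ODD kernel (time-odd solutions, data `(0, ψ₁)`) together give the kernel for every real `σ`
(`ParitySplit.kernel_all_of_even_odd`), hence the crux (`windowedShellChannels_of_subs`).  The two kernels are stated verbatim as the
stubs `stub_kernelEven` / `stub_kernelOdd` of `Cruxes/WindowedShellChannels/Lines/parity_kernels.lean` (route children
`WindowedShellKernelEven/Odd` once the split is filed).  No definitions, no sorry. [folklore in method; new]
-/

noncomputable section

set_option linter.dupNamespace false

namespace Summit.FinalStateConjecture.FinalStateConjecture.Theorems.WindowedShellChannelsSketch

open Literature.Geometry.Lorentzian Literature.Geometry.Lorentzian.ReggeWheeler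
open Summit.FinalStateConjecture.FinalStateConjecture.Theses.PhotonSphereChannels
open Filter Set MeasureTheory
open scoped ENNReal Topology

namespace ParitySplit

/-- A function of time parity `σ` with `σ ≠ ±1` vanishes identically. [folklore] -/
theorem eq_zero_of_parity_ne {σ : ℝ} (hσ : σ ≠ 1) (hσ' : σ ≠ -1) {ψ : ℝ → ℝ → ℝ}
    (hpar : ∀ t x, ψ (-t) x = σ * ψ t x) : ψ = fun _ _ => 0 := by
  funext t x
  have ha : ψ (-t) x = σ * ψ t x := hpar t x
  have hb : ψ t x = σ * ψ (-t) x := by simpa only [neg_neg] using hpar (-t) x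
  have h2 : (1 - σ ^ 2) * ψ t x = 0 := by linear_combination hb + σ * ha
  have h3 : 1 - σ ^ 2 ≠ 0 := by
    intro h
    have : (σ - 1) * (σ + 1) = 0 := by linear_combination -h
    rcases mul_eq_zero.1 this with h4 | h4
    · exact hσ (by linarith)
    · exact hσ' (by linarith)
  exact (mul_eq_zero.1 h2).resolve_left h3

/-- The total energy of the zero solution vanishes. [folklore] -/
theorem totalEnergy_zero_fun (V : ℝ → ℝ) (t : ℝ) : totalEnergy V (fun _ _ => (0 : ℝ)) t = 0 := by
  unfold totalEnergy energyDensity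
  simp

/-- **Parity glue**: the even kernel and the odd kernel give the polynomial-zone kernel for every real time parity `σ`
(`σ = 1`: the even kernel; `σ = −1`: the odd kernel; `σ² ≠ 1`: the solution vanishes and the inequality is `0 ≤ _`).
[folklore in method; new] -/
theorem kernel_all_of_even_odd
    (he : ∀ ρ : ℝ, 0 < ρ → ∃ h : ℝ, 0 ≤ h ∧ ∃ c : ℝ, 0 < c ∧ ∀ k : ℕ, ∃ ℓ₀ : ℕ,
      ∀ (s ℓ : ℕ), s ≤ 2 → s ≤ ℓ → ℓ₀ ≤ ℓ → ∀ ψ : ℝ → ℝ → ℝ,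
        IsRWSolution 1 s ℓ (tortoiseRadius one_pos 0) ψ → (∀ t x, ψ (-t) x = ψ t x) →
        CauchyDataSupportedOn ψ ({x : ℝ | ρ < |x|} ∩ Icc (-(((ℓ : ℝ) + 2) ^ k)) (((ℓ : ℝ) + 2) ^ k)) →
        totalEnergy (linePotential 1 s ℓ (tortoiseRadius one_pos 0)) ψ 0 ≠ ⊤ →
          ENNReal.ofReal c * totalEnergy (linePotential 1 s ℓ (tortoiseRadius one_pos 0)) ψ 0 ≤
            channelEnergy (linePotential 1 s ℓ (tortoiseRadius one_pos 0)) 0 (ρ - h) ψ atTop)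
    (ho : ∀ ρ : ℝ, 0 < ρ → ∃ h : ℝ, 0 ≤ h ∧ ∃ c : ℝ, 0 < c ∧ ∀ k : ℕ, ∃ ℓ₀ : ℕ,
      ∀ (s ℓ : ℕ), s ≤ 2 → s ≤ ℓ → ℓ₀ ≤ ℓ → ∀ ψ : ℝ → ℝ → ℝ,
        IsRWSolution 1 s ℓ (tortoiseRadius one_pos 0) ψ → (∀ t x, ψ (-t) x = -ψ t x) →
        CauchyDataSupportedOn ψ ({x : ℝ | ρ < |x|} ∩ Icc (-(((ℓ : ℝ) + 2) ^ k)) (((ℓ : ℝ) + 2) ^ k)) →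
        totalEnergy (linePotential 1 s ℓ (tortoiseRadius one_pos 0)) ψ 0 ≠ ⊤ →
          ENNReal.ofReal c * totalEnergy (linePotential 1 s ℓ (tortoiseRadius one_pos 0)) ψ 0 ≤
            channelEnergy (linePotential 1 s ℓ (tortoiseRadius one_pos 0)) 0 (ρ - h) ψ atTop) (σ : ℝ) :
    ∀ ρ : ℝ, 0 < ρ → ∃ h : ℝ, 0 ≤ h ∧ ∃ c : ℝ, 0 < c ∧ ∀ k : ℕ, ∃ ℓ₀ : ℕ,
      ∀ (s ℓ : ℕ), s ≤ 2 → s ≤ ℓ → ℓ₀ ≤ ℓ → ∀ ψ : ℝ → ℝ → ℝ,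
        IsRWSolution 1 s ℓ (tortoiseRadius one_pos 0) ψ → (∀ t x, ψ (-t) x = σ * ψ t x) →
        CauchyDataSupportedOn ψ ({x : ℝ | ρ < |x|} ∩ Icc (-(((ℓ : ℝ) + 2) ^ k)) (((ℓ : ℝ) + 2) ^ k)) →
        totalEnergy (linePotential 1 s ℓ (tortoiseRadius one_pos 0)) ψ 0 ≠ ⊤ →
          ENNReal.ofReal c * totalEnergy (linePotential 1 s ℓ (tortoiseRadius one_pos 0)) ψ 0 ≤
            channelEnergy (linePotential 1 s ℓ (tortoiseRadius one_pos 0)) 0 (ρ - h) ψ atTop := by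
  by_cases h1 : σ = 1
  · subst h1
    intro ρ hρ
    obtain ⟨h, hh, c, hc, H⟩ := he ρ hρ
    refine ⟨h, hh, c, hc, fun k => ?_⟩
    obtain ⟨ℓ₀, Hk⟩ := H k
    exact ⟨ℓ₀, fun s ℓ hs hsℓ hℓ ψ hψ hpar hsupp hfin =>
      Hk s ℓ hs hsℓ hℓ ψ hψ (fun t x => by rw [← one_mul (ψ t x)]; exact hpar t x) hsupp hfin⟩
  by_cases h2 : σ = -1
  · subst h2
    intro ρ hρ
    obtain ⟨h, hh, c, hc, H⟩ := ho ρ hρ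
    refine ⟨h, hh, c, hc, fun k => ?_⟩
    obtain ⟨ℓ₀, Hk⟩ := H k
    exact ⟨ℓ₀, fun s ℓ hs hsℓ hℓ ψ hψ hpar hsupp hfin =>
      Hk s ℓ hs hsℓ hℓ ψ hψ (fun t x => by rw [← neg_one_mul (ψ t x)]; exact hpar t x) hsupp hfin⟩
  intro ρ hρ
  refine ⟨0, le_rfl, 1, one_pos, fun k => ⟨0, fun s ℓ hs hsℓ hℓ ψ hψ hpar hsupp hfin => ?_⟩⟩
  have hz := eq_zero_of_parity_ne h1 h2 hpar
  subst hz
  rw [totalEnergy_zero_fun, mul_zero]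
  exact bot_le

end ParitySplit

/-- **The crux from its two parity kernels** (the strategist's split glue `windowedShellChannels_of_subs`): the EVEN kernel
(= `stub_kernelEven`, route child `WindowedShellKernelEven`) and the ODD kernel (= `stub_kernelOdd`, route child
`WindowedShellKernelOdd`) imply `WindowedShellChannels`, through `ParitySplit.kernel_all_of_even_odd` and the landed kernel
reduction `windowedShellChannels_of_zonePoly` (p135139). [folklore in method; new] -/
theorem windowedShellChannels_of_subs
    (he : ∀ ρ : ℝ, 0 < ρ → ∃ h : ℝ, 0 ≤ h ∧ ∃ c : ℝ, 0 < c ∧ ∀ k : ℕ, ∃ ℓ₀ : ℕ,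
      ∀ (s ℓ : ℕ), s ≤ 2 → s ≤ ℓ → ℓ₀ ≤ ℓ → ∀ ψ : ℝ → ℝ → ℝ,
        IsRWSolution 1 s ℓ (tortoiseRadius one_pos 0) ψ → (∀ t x, ψ (-t) x = ψ t x) →
        CauchyDataSupportedOn ψ ({x : ℝ | ρ < |x|} ∩ Icc (-(((ℓ : ℝ) + 2) ^ k)) (((ℓ : ℝ) + 2) ^ k)) →
        totalEnergy (linePotential 1 s ℓ (tortoiseRadius one_pos 0)) ψ 0 ≠ ⊤ →
          ENNReal.ofReal c * totalEnergy (linePotential 1 s ℓ (tortoiseRadius one_pos 0)) ψ 0 ≤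
            channelEnergy (linePotential 1 s ℓ (tortoiseRadius one_pos 0)) 0 (ρ - h) ψ atTop)
    (ho : ∀ ρ : ℝ, 0 < ρ → ∃ h : ℝ, 0 ≤ h ∧ ∃ c : ℝ, 0 < c ∧ ∀ k : ℕ, ∃ ℓ₀ : ℕ,
      ∀ (s ℓ : ℕ), s ≤ 2 → s ≤ ℓ → ℓ₀ ≤ ℓ → ∀ ψ : ℝ → ℝ → ℝ,
        IsRWSolution 1 s ℓ (tortoiseRadius one_pos 0) ψ → (∀ t x, ψ (-t) x = -ψ t x) →
        CauchyDataSupportedOn ψ ({x : ℝ | ρ < |x|} ∩ Icc (-(((ℓ : ℝ) + 2) ^ k)) (((ℓ : ℝ) + 2) ^ k)) →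
        totalEnergy (linePotential 1 s ℓ (tortoiseRadius one_pos 0)) ψ 0 ≠ ⊤ →
          ENNReal.ofReal c * totalEnergy (linePotential 1 s ℓ (tortoiseRadius one_pos 0)) ψ 0 ≤
            channelEnergy (linePotential 1 s ℓ (tortoiseRadius one_pos 0)) 0 (ρ - h) ψ atTop) :
    WindowedShellChannels :=
  windowedShellChannels_of_zonePoly (ParitySplit.kernel_all_of_even_odd he ho)

end Summit.FinalStateConjecture.FinalStateConjecture.Theorems.WindowedShellChannelsSketch

end
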